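import Mathlib.Analysis.MeanInequalitiesPow
import Mathlib.Analysis.Convex.SpecificFunctions.Pow
import Mathlib.Analysis.Convex.Jensen
import HarnessLib

/-!
# Power-mean inequalities for the Evans–Krylov summation (Gilbarg–Trudinger (17.49)–(17.51))

The elementary `rpow` facts used to sum the weak Harnack inequalities over the Motzkin–Wasow
directions when working with `p`-th powers (`0 < p ≤ 1`) instead of the quasi-norm
`Φ_p = (⨍ ·^p)^{1/p}`:

* `rpow_sum_le_sum_rpow` — subadditivity `(Σ x_k)^p ≤ Σ x_k^p`;
* `sum_rpow_le_card_rpow_sum` — power mean `Σ_{k} x_k^p ≤ N^{1-p} (Σ x_k)^p` (Jensen for the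
  concave `t ↦ t^p`);
* `rpow_inv_le_of_rpow_le_add` — taking `p`-th roots: `x^p ≤ A^p·y^p + z` with all terms
  nonnegative gives `x ≤ 2^{1/p} (A y + z^{1/p})`.

## References

* D. Gilbarg, N. S. Trudinger, *Elliptic Partial Differential Equations of Second Order* (2001),
  §17.4, (17.49)–(17.51) ("`Φ_{p,R}(Σ_{k≠l} …) ≤ N^{1/p} Σ …`"). [GilbargTrudinger2001]
-/

noncomputable section

open Finset

namespace Literature.Analysis.PDE.EvansKrylov

variable {K : Type*}

/-- **Subadditivity**: `(Σ_k x_k)^p ≤ Σ_k x_k^p` for `x_k ≥ 0`, `0 ≤ p ≤ 1`. [folklore] -/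
theorem rpow_sum_le_sum_rpow {p : ℝ} (hp0 : 0 < p) (hp1 : p ≤ 1) (s : Finset K) {x : K → ℝ}
    (hx : ∀ k ∈ s, 0 ≤ x k) : (∑ k ∈ s, x k) ^ p ≤ ∑ k ∈ s, x k ^ p := by
  classical
  induction s using Finset.induction_on with
  | empty =>
    simp only [Finset.sum_empty]
    rw [Real.zero_rpow hp0.ne']
  | insert k s hk ih =>
    rw [Finset.sum_insert hk, Finset.sum_insert hk]
    have hxk : 0 ≤ x k := hx k (Finset.mem_insert_self k s)
    have hxs : ∀ j ∈ s, 0 ≤ x j := fun j hj ↦ hx j (Finset.mem_insert_of_mem hj)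
    have hsum : 0 ≤ ∑ j ∈ s, x j := Finset.sum_nonneg hxs
    exact (Real.rpow_add_le_add_rpow hxk hsum hp0.le hp1).trans (add_le_add le_rfl (ih hxs))

/-- **Power mean** (Jensen for the concave `t ↦ t^p`, `0 ≤ p ≤ 1`):
`Σ_k x_k^p ≤ N^{1-p} (Σ_k x_k)^p`, `N = |s| ≥ 1`. [folklore] -/
theorem sum_rpow_le_card_rpow_sum {p : ℝ} (hp0 : 0 ≤ p) (hp1 : p ≤ 1) (s : Finset K) (hs : s.Nonempty)
    {x : K → ℝ} (hx : ∀ k ∈ s, 0 ≤ x k) :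
    ∑ k ∈ s, x k ^ p ≤ (s.card : ℝ) ^ (1 - p) * (∑ k ∈ s, x k) ^ p := by
  set N : ℝ := (s.card : ℝ) with hN
  have hN0 : 0 < N := by rw [hN]; exact_mod_cast hs.card_pos
  -- Jensen with equal weights `1/N`
  have hJ := (Real.concaveOn_rpow hp0 hp1).le_map_sum (t := s) (w := fun _ ↦ N⁻¹) (p := x)
    (fun _ _ ↦ inv_nonneg.2 hN0.le) (by
      rw [Finset.sum_const, nsmul_eq_mul, ← hN, mul_inv_cancel₀ hN0.ne'])
    (fun k hk ↦ Set.mem_Ici.2 (hx k hk))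
  simp only [smul_eq_mul] at hJ
  rw [← Finset.mul_sum, ← Finset.mul_sum, Real.mul_rpow (inv_nonneg.2 hN0.le) (Finset.sum_nonneg hx)]
    at hJ
  -- `N⁻¹ Σ x^p ≤ N^{-p} (Σ x)^p`  ⇒  `Σ x^p ≤ N^{1-p} (Σ x)^p`
  have hNp : (N⁻¹) ^ p = N ^ (-p) := by rw [Real.inv_rpow hN0.le, Real.rpow_neg hN0.le]
  rw [hNp] at hJ
  have := mul_le_mul_of_nonneg_left hJ hN0.le
  rw [← mul_assoc, mul_inv_cancel₀ hN0.ne', one_mul, ← mul_assoc] at this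
  have e : N ^ (1 - p) = N * N ^ (-p) := by
    rw [show (1 - p) = 1 + (-p) by ring, Real.rpow_add hN0, Real.rpow_one]
  rw [e]; exact this

/-- **Taking `p`-th roots**: from `x^p ≤ y + z` with `x, y, z ≥ 0`, `0 < p ≤ 1`:
`x ≤ 2^{1/p} max(y, z)^{1/p} ≤ 2^{1/p}(y^{1/p} + z^{1/p})`. [folklore] -/
theorem le_of_rpow_le_add {p x y z : ℝ} (hp0 : 0 < p) (hx : 0 ≤ x) (hy : 0 ≤ y) (hz : 0 ≤ z)
    (h : x ^ p ≤ y + z) : x ≤ (2 : ℝ) ^ p⁻¹ * (y ^ p⁻¹ + z ^ p⁻¹) := by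
  have hmax : y + z ≤ 2 * max y z := by
    rcases le_total y z with hyz | hyz
    · rw [max_eq_right hyz]; linarith
    · rw [max_eq_left hyz]; linarith
  have h1 : x ^ p ≤ 2 * max y z := h.trans hmax
  have h2 : x = (x ^ p) ^ p⁻¹ := by rw [← Real.rpow_mul hx, mul_inv_cancel₀ hp0.ne', Real.rpow_one]
  rw [h2]
  calc (x ^ p) ^ p⁻¹ ≤ (2 * max y z) ^ p⁻¹ :=
        Real.rpow_le_rpow (Real.rpow_nonneg hx p) h1 (inv_nonneg.2 hp0.le)
    _ = (2 : ℝ) ^ p⁻¹ * (max y z) ^ p⁻¹ := Real.mul_rpow zero_le_two (le_max_of_le_left hy)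
    _ ≤ (2 : ℝ) ^ p⁻¹ * (y ^ p⁻¹ + z ^ p⁻¹) := by
        refine mul_le_mul_of_nonneg_left ?_ (by positivity)
        rcases le_total y z with hyz | hyz
        · rw [max_eq_right hyz]; linarith [Real.rpow_nonneg hy p⁻¹]
        · rw [max_eq_left hyz]; linarith [Real.rpow_nonneg hz p⁻¹]

/-- `(A^p y^p)^{1/p} = A y` for `A, y ≥ 0`, `p > 0`. [folklore] -/
theorem rpow_inv_mul_rpow {p A y : ℝ} (hp0 : 0 < p) (hA : 0 ≤ A) (hy : 0 ≤ y) :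
    (A ^ p * y ^ p) ^ p⁻¹ = A * y := by
  rw [← Real.mul_rpow hA hy, ← Real.rpow_mul (mul_nonneg hA hy), mul_inv_cancel₀ hp0.ne',
    Real.rpow_one]

end Literature.Analysis.PDE.EvansKrylov

end
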